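import Summits.HubbardSuperconductivity.HubbardLadder.PairFieldCeilingUniform
import HarnessLib

/-!
# Rungs R3/R4 — uniform ceilings on the `d`-wave order parameter, part 2: producers, the headline
# data type, the edge to H⁻ and the certificate-free Yang rung

HONEST FRAMING (page 1): ladder R1–R4 with certified numbers; no claim on H/H₀. This file proves
EDGES only; no certificate of the kind it consumes has been computed (see the module docstring of
`PairFieldCeilingUniform.lean`, of which this is the second part after the gate's 400-line split:
§3 `UpperRowCertTT'` / `UpperBlockCertTT'` producers from ONE translation-invariant upper
certificate per displacement, §4 `R4CeilingBlockCert` at `(t, t', U) = (1, t', 8)`, `δ = 1/8`,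
§5 the edge `noDWaveOrderPureU8Eighth_of_ceilingBlockCerts`, §6 rung 0: Yang's kinematic ceiling
`limsup dWaveOrderParamSq ≤ 2(1 − δ²)` for EVERY Hamiltonian family). Every hypothesis is a binder or a
structure field; nothing about the Hubbard ground state is assumed.
-/

namespace Summit.HubbardSuperconductivity.HubbardLadder

open Matrix Finset Filter Literature.Probability.LatticeModels
  Literature.MathematicalPhysics.QuantumLattice
open Literature.MathematicalPhysics.QuantumLattice.ThermodynamicLimit
open Literature.MathematicalPhysics.QuantumManyBody.StateRelaxation
open scoped ComplexOrder Topology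

noncomputable section

/-! ## §3 Producers: uniform upper rows from ONE translation-invariant upper certificate -/

/-- **R3-∞ upper-row data** at displacement `r` in the `t–t'` model at doping `δ`: a
translation-invariant UPPER certificate for `Δ_0† Δ_r` (`ε = −1`), with the density offset
`ν = (1 − δ)/2` and an energy ceiling strictly above the TL energy density `e(t, t', U, 1 − δ)` (any
certified R1 upper row discharges the latter). Certificate data only. [cite: WangEtAl2024, §III] -/
structure UpperRowCertTT' (t t' U δ : ℝ) (r : Site 2) where
  /-- the upper certificate for `Δ_0† Δ_r` -/
  C : PairWindowCertTT' t t' U r (-1)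
  /-- density offset of doping `δ` -/
  hν : C.ν = (1 - δ) / 2
  /-- its energy ceiling lies strictly above the TL energy density -/
  hu : energyDensityTT' t t' U (1 - δ) < C.u

/-- Archimedean helper: `M / L² < g` on all large sides. [folklore] -/
private theorem exists_forall_div_sq_lt' (M : ℝ) {g : ℝ} (hg : 0 < g) :
    ∃ L₀ : ℕ, ∀ L : ℕ, L₀ ≤ L → M / (L : ℝ) ^ 2 < g := by
  obtain ⟨L₀, hL₀⟩ := exists_nat_gt (M / g)
  refine ⟨L₀ + 1, fun L hL => ?_⟩
  have hLr : (L₀ : ℝ) + 1 ≤ L := by exact_mod_cast hL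
  have hL0 : (0 : ℝ) ≤ L₀ := Nat.cast_nonneg L₀
  have hL1 : (1 : ℝ) ≤ L := by linarith
  have hL2 : (0 : ℝ) < (L : ℝ) ^ 2 := by nlinarith
  rw [div_lt_iff₀ hL2]
  rw [div_lt_iff₀ hg] at hL₀
  nlinarith [mul_le_mul_of_nonneg_right (show (L : ℝ) ≤ (L : ℝ) ^ 2 by nlinarith) hg.le]

namespace UpperRowCertTT'

variable {t t' U δ : ℝ} {r : Site 2}

/-- **What one upper certificate certifies, uniformly in `L`.** For `U ≥ 0`, `-1 < δ ≤ 1` and every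
`a > −q`: `P̄_d(L, r; ψ) ≤ a` for EVERY unit ground state `ψ` of the sector
`(electronNumber δ L, S^z = 0)` of `hubbardTorusTT' L t t' U` on EVERY side `L ≥ L₁`
(`PairWindowCertTT'.bound_le_avgPairCorr` with `ε = −1`, the energy ceiling discharged by
`uniformEnergyCeiling_of_energyDensityTT'_lt`, the density term by `bound_ge_eventually`, window
injectivity by `exists_forall_le_injOn_proj`). [cite: WangEtAl2024, §III] -/
theorem avgPairCorr_le_eventually (R : UpperRowCertTT' t t' U δ r) (hU : 0 ≤ U) (hδ0 : -1 < δ)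
    (hδ1 : δ ≤ 1) {a : ℝ} (ha : -R.C.q < a) :
    ∃ L₁ : ℕ, ∀ L : ℕ, L₁ ≤ L → ∀ ψ : Fock (Orb (FermionTorus 2 L)), star ψ ⬝ᵥ ψ = 1 →
      IsGroundStateInSector (hubbardTorusTT' L t t' U) (electronNumber δ L) 0 ψ →
        avgPairCorr L r ψ ≤ a := by
  obtain ⟨C, hν, hu⟩ := R
  obtain ⟨L₀, hL₀⟩ := uniformEnergyCeiling_of_energyDensityTT'_lt (t := t) (t' := t') hU hδ0 hδ1 hu
  obtain ⟨Lq, hLq⟩ := C.bound_ge_eventually hδ1 hν (b := -a) (by simp only at ha ⊢; linarith)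
  obtain ⟨La, hLa⟩ := exists_forall_le_injOn_proj (thicken C.Λ' 1)
  refine ⟨max 3 (max L₀ (max Lq La)), fun L hL ψ h1 hgs => ?_⟩
  simp only [max_le_iff] at hL
  obtain ⟨h3, hL0, hLq', hLa'⟩ := hL
  obtain ⟨m, rfl⟩ : ∃ m, L = m + 1 := ⟨L - 1, by omega⟩
  have key := C.bound_le_avgPairCorr m h3 (hLa _ hLa') (pairNumber_le_card hδ0.le (m + 1))
    (hL₀ (m + 1) hL0) hgs h1
  have hq := hLq (m + 1) hLq'
  linarith

end UpperRowCertTT'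

/-- **R3-∞ upper-block data** in the `t–t'` model at doping `δ`: a nonempty block `S` and one upper
row datum for every ordered pair `(s, s') ∈ S × S` (displacement `s' − s`; `|S|²` certificates, fewer
up to lattice symmetries at the producer's end). Certificate data only. [cite: WangEtAl2024, §III] -/
structure UpperBlockCertTT' (t t' U δ : ℝ) where
  /-- the block -/
  S : Finset (Site 2)
  hS : S.Nonempty
  /-- the upper rows, one per ordered pair of the block -/
  row : ∀ s ∈ S, ∀ s' ∈ S, UpperRowCertTT' t t' U δ (s' - s)

namespace UpperBlockCertTT'

variable {t t' U δ : ℝ}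

/-- The block's certified constant: `E = |S|⁻² Σ_{s,s' ∈ S} (−q_{s,s'})`. [folklore] -/
def E (B : UpperBlockCertTT' t t' U δ) : ℝ :=
  (∑ s ∈ B.S.attach, ∑ s' ∈ B.S.attach, -(B.row s s.2 s' s'.2).C.q) / (#B.S : ℝ) ^ 2

/-- **Ceiling from an upper block, with any margin.** For `U ≥ 0`, `-1 < δ ≤ 1` and every `g > 0`:
a `UniformPairFieldCeilingCert` for `(hubbardTorusTT' · t t' U, electronNumber δ)` with `ε = E + g`.
[cite: WangEtAl2024, §III] -/
theorem exists_ceilingCert (B : UpperBlockCertTT' t t' U δ) (hU : 0 ≤ U) (hδ0 : -1 < δ) (hδ1 : δ ≤ 1)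
    {g : ℝ} (hg : 0 < g) :
    ∃ cert : UniformPairFieldCeilingCert (fun L => hubbardTorusTT' L t t' U) (electronNumber δ),
      cert.ε = B.E + g := by
  classical
  -- one side `L₁(s,s')` per ordered pair, with margin `g` on each row
  have hrow : ∀ p : B.S × B.S, ∃ L₁ : ℕ, ∀ L : ℕ, L₁ ≤ L → ∀ ψ : Fock (Orb (FermionTorus 2 L)),
      star ψ ⬝ᵥ ψ = 1 → IsGroundStateInSector (hubbardTorusTT' L t t' U) (electronNumber δ L) 0 ψ →
        avgPairCorr L ((p.2 : Site 2) - p.1) ψ ≤ -(B.row p.1 p.1.2 p.2 p.2.2).C.q + g :=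
    fun p => (B.row p.1 p.1.2 p.2 p.2.2).avgPairCorr_le_eventually hU hδ0 hδ1 (by linarith)
  choose L₁ hL₁ using hrow
  refine ⟨UniformPairFieldCeilingCert.ofRows (H := fun L => hubbardTorusTT' L t t' U)
    (N := electronNumber δ) B.hS
    (fun s s' => if h : s ∈ B.S ∧ s' ∈ B.S then -(B.row s h.1 s' h.2).C.q + g else 0)
    (Finset.univ.sup L₁) (fun s hs s' hs' L hL _ ψ h1 hgs => ?_), ?_⟩
  · rw [dif_pos ⟨hs, hs'⟩]
    exact hL₁ (⟨s, hs⟩, ⟨s', hs'⟩) L (le_trans (Finset.le_sup (Finset.mem_univ _)) hL) ψ h1 hgs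
  · -- the constant: `|S|⁻² Σ (−q + g) = E + g`
    show (∑ s ∈ B.S, ∑ s' ∈ B.S, (if h : s ∈ B.S ∧ s' ∈ B.S then -(B.row s h.1 s' h.2).C.q + g else 0)) /
        (#B.S : ℝ) ^ 2 = B.E + g
    have hS' : (0 : ℝ) < (#B.S : ℝ) := by exact_mod_cast Finset.card_pos.2 B.hS
    rw [E, ← Finset.sum_attach B.S]
    have inner : ∀ s : B.S, (∑ s' ∈ B.S, (if h : (s : Site 2) ∈ B.S ∧ s' ∈ B.S then
        -(B.row s h.1 s' h.2).C.q + g else 0)) =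
        ∑ s' ∈ B.S.attach, (-(B.row s s.2 s' s'.2).C.q + g) := by
      intro s
      rw [← Finset.sum_attach B.S]
      refine Finset.sum_congr rfl fun s' _ => ?_
      rw [dif_pos ⟨s.2, s'.2⟩]
    rw [Finset.sum_congr rfl fun s _ => inner s]
    simp only [Finset.sum_add_distrib, Finset.sum_const, Finset.card_attach]
    field_simp
    ring

/-- **What an upper block certifies**: `limsup_k dWaveOrderParamSq ψ k ≤ E` for EVERY admissible
ground-state sequence of `hubbardTorusTT' L t t' U` at doping `δ` (`U ≥ 0`, `-1 < δ ≤ 1`).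
[cite: Scalapino1995, §2 eq. (2.4)] -/
theorem limsup_dWaveOrderParamSq_le (B : UpperBlockCertTT' t t' U δ) (hU : 0 ≤ U) (hδ0 : -1 < δ)
    (hδ1 : δ ≤ 1) (ψ : ∀ L, Fock (Orb (FermionTorus 2 L)))
    (hψ : ∀ L, Even L → star (ψ L) ⬝ᵥ ψ L = 1 ∧
      IsGroundStateInSector (hubbardTorusTT' L t t' U) (electronNumber δ L) 0 (ψ L)) :
    limsup (dWaveOrderParamSq ψ) atTop ≤ B.E := by
  refine le_of_forall_pos_le_add fun g hg => ?_
  obtain ⟨cert, hε⟩ := B.exists_ceilingCert hU hδ0 hδ1 hg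
  exact hε ▸ cert.limsup_dWaveOrderParamSq_le ψ hψ

end UpperBlockCertTT'

/-! ## §4 The headline data type: `(t, t', U) = (1, t', 8)`, doping `1/8` -/

/-- **Target-format R4 ceiling data at the headline locus (no instance computed).** A nonempty block
`S` and, for every ordered pair of `S`, a translation-invariant UPPER certificate for
`Δ_0† Δ_{s'−s}` in the model `(1, t', 8)` with `ν = 7/16` and energy ceiling strictly above
`e(1, t', 8, 7/8)`. The first producible members: `S = {0}` (one certificate, window class `3 × 3`),
`S = {0, e₁}` and the `2 × 2` block (window class `4 × 4`). [cite: WangEtAl2024, §III]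
[cite: QinEtAl2020, §III.B] -/
structure R4CeilingBlockCert (t' : ℝ) where
  /-- the block -/
  S : Finset (Site 2)
  hS : S.Nonempty
  /-- the upper certificates -/
  C : ∀ s ∈ S, ∀ s' ∈ S, PairWindowCertTT' 1 t' 8 (s' - s) (-1)
  /-- density offsets of doping `1/8` -/
  hν : ∀ s (hs : s ∈ S) s' (hs' : s' ∈ S), (C s hs s' hs').ν = 7 / 16
  /-- energy ceilings strictly above the TL energy density -/
  hu : ∀ s (hs : s ∈ S) s' (hs' : s' ∈ S), energyDensityTT' 1 t' 8 (7 / 8) < (C s hs s' hs').u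

namespace R4CeilingBlockCert

variable {t' : ℝ}

/-- The underlying upper block at doping `1/8`. [folklore] -/
def toUpperBlock (R : R4CeilingBlockCert t') : UpperBlockCertTT' 1 t' 8 (1 / 8) where
  S := R.S
  hS := R.hS
  row s hs s' hs' :=
    { C := R.C s hs s' hs'
      hν := by rw [R.hν]; norm_num
      hu := by have h := R.hu s hs s' hs'; norm_num at h ⊢; exact h }

/-- The certified ceiling `E = |S|⁻² Σ_{s,s'} (−q_{s,s'})`. [folklore] -/
def E (R : R4CeilingBlockCert t') : ℝ := R.toUpperBlock.E

/-- **What the data certify in the `t–t'` model**: `limsup_k dWaveOrderParamSq ψ k ≤ E` for EVERY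
admissible ground-state sequence of `hubbardTorusTT' L 1 t' 8` at doping `1/8` (the hypotheses of
`Targets.DWaveOrderTPrimeQuarterU8Eighth` at `t' = -1/4`). [cite: XuEtAl2024, eq. (1)] -/
theorem limsup_dWaveOrderParamSq_le (R : R4CeilingBlockCert t') (N : ℕ → ℕ)
    (ψ : ∀ L, Fock (Orb (FermionTorus 2 L)))
    (hNψ : ∀ L, Even L → N L = 2 * ⌊(1 - 1 / 8) * (L : ℝ) ^ 2 / 2⌋₊ ∧ star (ψ L) ⬝ᵥ ψ L = 1 ∧
      IsGroundStateInSector (hubbardTorusTT' L 1 t' 8) (N L) 0 (ψ L)) :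
    limsup (dWaveOrderParamSq ψ) atTop ≤ R.E := by
  refine R.toUpperBlock.limsup_dWaveOrderParamSq_le (by norm_num) (by norm_num) (by norm_num) ψ
    fun L hL => ?_
  obtain ⟨hN, h1, hgs⟩ := hNψ L hL
  rw [hN] at hgs
  exact ⟨h1, hgs⟩

/-- **What the data certify in the PURE model (`t' = 0`)**, under the hypotheses of
`NoDWaveOrderPureU8Eighth` verbatim: `limsup_k dWaveOrderParamSq ψ k ≤ E` — a BOUND on the order
parameter, not its vanishing (`hubbardTorusTT'_zero`). [cite: QinEtAl2020, §IV p. 11] -/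
theorem limsup_dWaveOrderParamSq_le_pure (R : R4CeilingBlockCert 0) (N : ℕ → ℕ)
    (ψ : ∀ L, Fock (Orb (FermionTorus 2 L)))
    (hNψ : ∀ L, Even L → N L = 2 * ⌊(1 - 1 / 8) * (L : ℝ) ^ 2 / 2⌋₊ ∧ star (ψ L) ⬝ᵥ ψ L = 1 ∧
      IsGroundStateInSector (hubbardTorus 2 L 1 8) (N L) 0 (ψ L)) :
    limsup (dWaveOrderParamSq ψ) atTop ≤ R.E := by
  refine R.limsup_dWaveOrderParamSq_le N ψ fun L hL => ?_
  rw [hubbardTorusTT'_zero]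
  exact hNψ L hL

end R4CeilingBlockCert

/-! ## §5 Edge to the typed target H⁻ -/

/-- **Edge to H⁻ (`NoDWaveOrderPureU8Eighth`).** Ceiling blocks of EVERY size in the pure model —
for every `ε > 0` an `R4CeilingBlockCert 0` with `E ≤ ε` — prove the cell target H⁻. A single block
only BOUNDS the order parameter; by §1 the block constants can approach `0` only through ever larger
blocks and only if the order parameter itself vanishes, so this edge is the honest statement of what
the block family could decide in the limit, not a plan. [cite: QinEtAl2020, §IV p. 11] -/
theorem noDWaveOrderPureU8Eighth_of_ceilingBlockCerts
    (h : ∀ ε > 0, ∃ R : R4CeilingBlockCert 0, R.E ≤ ε) : NoDWaveOrderPureU8Eighth := by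
  intro N ψ hNψ
  have hψ : ∀ L, Even L → star (ψ L) ⬝ᵥ ψ L = 1 ∧
      IsGroundStateInSector (hubbardTorusTT' L 1 0 8) (electronNumber (1 / 8) L) 0 (ψ L) := by
    intro L hL
    obtain ⟨hN, h1, hgs⟩ := hNψ L hL
    rw [hN] at hgs
    rw [hubbardTorusTT'_zero]
    exact ⟨h1, hgs⟩
  refine UniformPairFieldCeilingCert.tendsto_zero_of_forall (H := fun L => hubbardTorusTT' L 1 0 8)
    (N := electronNumber (1 / 8)) (fun ε hε => ?_) ψ hψ
  obtain ⟨R, hR⟩ := h (ε / 2) (half_pos hε)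
  obtain ⟨cert, hc⟩ := R.toUpperBlock.exists_ceilingCert (by norm_num) (by norm_num) (by norm_num)
    (half_pos hε)
  have hR' : R.toUpperBlock.E ≤ ε / 2 := hR
  exact ⟨cert, by rw [hc]; linarith⟩


/-! ## §6 Rung 0 (certificate-free): Yang's kinematic ceiling as a `UniformPairFieldCeilingCert` -/

/-- **Yang's bound for the pair-field density** (tree: `re_expect_pairField_dWave_conjTranspose_mul_le_yang`):
for `L ≥ 3`, `N` even, `N ≤ 2L²` and every unit `N`-particle vector `ψ`,
`p_d(L; ψ) ≤ 2N(2L² − N + 2)/L⁴` — any Hamiltonian, ground state or not. [cite: Yang1962, §4] -/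
theorem pairFieldDensity_le_yang {L : ℕ} (hL : 3 ≤ L) {N : ℕ} (hN : Even N) (hNL : N ≤ 2 * L ^ 2)
    {ψ : Fock (Orb (FermionTorus 2 L))} (hψN : IsNParticle N ψ) (hψ : star ψ ⬝ᵥ ψ = 1) :
    pairFieldDensity L ψ ≤ 2 * (N : ℝ) * (2 * (L : ℝ) ^ 2 - N + 2) / (L : ℝ) ^ 4 := by
  obtain ⟨L', rfl⟩ : ∃ L', L = L' + 1 := ⟨L - 1, by omega⟩
  rw [pairFieldDensity_succ]
  have h := re_expect_pairField_dWave_conjTranspose_mul_le_yang (L' + 1) hL hN hNL hψN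
  have h1 : (star ψ ⬝ᵥ ψ).re = 1 := by rw [hψ]; simp
  rw [h1, mul_one] at h
  exact div_le_div_of_nonneg_right h (by positivity)

/-- The summit's electron number is at most `(1-δ)L²`. [cite: ArovasBergKivelsonRaghu2022, §9] -/
theorem electronNumber_le (δ : ℝ) (hδ1 : δ ≤ 1) (L : ℕ) :
    (electronNumber δ L : ℝ) ≤ (1 - δ) * (L : ℝ) ^ 2 := by
  have hx : 0 ≤ (1 - δ) * (L : ℝ) ^ 2 / 2 := by
    have : 0 ≤ 1 - δ := by linarith
    positivity
  have hfl := Nat.floor_le hx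
  simp only [electronNumber, Nat.cast_mul, Nat.cast_ofNat]
  linarith

/-- **Yang's ceiling at hole doping `δ ∈ [0, 1]`**: for `L ≥ 3` and every unit vector with
`electronNumber δ L` particles, `p_d(L; ψ) ≤ 2(1 − δ²) + 4(1 − δ)/L²` (monotonicity of
`n ↦ n(2L² + 2 − n)` on `n ≤ L² + 1` and `N ≤ (1-δ)L² ≤ L²`). [cite: Yang1962, §4] -/
theorem pairFieldDensity_le_yang_doping {δ : ℝ} (hδ0 : 0 ≤ δ) (hδ1 : δ ≤ 1) {L : ℕ} (hL : 3 ≤ L)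
    {ψ : Fock (Orb (FermionTorus 2 L))} (hψN : IsNParticle (electronNumber δ L) ψ)
    (hψ : star ψ ⬝ᵥ ψ = 1) :
    pairFieldDensity L ψ ≤ 2 * (1 - δ ^ 2) + 4 * (1 - δ) / (L : ℝ) ^ 2 := by
  set N := electronNumber δ L with hNdef
  have hL0 : (0 : ℝ) < (L : ℝ) := by exact_mod_cast (show 0 < L by omega)
  have hL2 : (0 : ℝ) < (L : ℝ) ^ 2 := by positivity
  have hNle : (N : ℝ) ≤ (1 - δ) * (L : ℝ) ^ 2 := electronNumber_le δ hδ1 L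
  have hNle' : (N : ℝ) ≤ (L : ℝ) ^ 2 := hNle.trans (by nlinarith)
  have hN2 : N ≤ 2 * L ^ 2 := by
    have : (N : ℝ) ≤ 2 * (L : ℝ) ^ 2 := hNle'.trans (by nlinarith)
    exact_mod_cast this
  have hNeven : Even N := ⟨⌊(1 - δ) * (L : ℝ) ^ 2 / 2⌋₊, by simp [hNdef, electronNumber, two_mul]⟩
  have hY := pairFieldDensity_le_yang hL hNeven hN2 hψN hψ
  -- monotonicity: `N(2L² − N + 2) ≤ (1-δ)L²((1+δ)L² + 2)`
  have hmono : (N : ℝ) * (2 * (L : ℝ) ^ 2 - N + 2) ≤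
      (1 - δ) * (L : ℝ) ^ 2 * ((1 + δ) * (L : ℝ) ^ 2 + 2) := by
    have hba : 0 ≤ (1 - δ) * (L : ℝ) ^ 2 - N := sub_nonneg.2 hNle
    have hsum : 0 ≤ 2 * (L : ℝ) ^ 2 + 2 - N - (1 - δ) * (L : ℝ) ^ 2 := by nlinarith
    nlinarith [mul_nonneg hba hsum]
  calc pairFieldDensity L ψ ≤ 2 * (N : ℝ) * (2 * (L : ℝ) ^ 2 - N + 2) / (L : ℝ) ^ 4 := hY
    _ ≤ 2 * ((1 - δ) * (L : ℝ) ^ 2 * ((1 + δ) * (L : ℝ) ^ 2 + 2)) / (L : ℝ) ^ 4 :=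
        div_le_div_of_nonneg_right (by linarith [hmono]) (by positivity)
    _ = 2 * (1 - δ ^ 2) + 4 * (1 - δ) / (L : ℝ) ^ 2 := by
        field_simp
        ring

namespace UniformPairFieldCeilingCert

/-- **Rung 0 of the ceiling format, certificate-free**: for EVERY Hamiltonian family `H` and every
hole doping `δ ∈ [0, 1]`, Yang's bound is a uniform ceiling certificate with constant
`2(1 − δ²) + g`, any `g > 0` (the `4(1-δ)/L²` tail is absorbed from `L₀(g)` on). Nothing about
`H` is used: sector ground states are `N`-particle unit vectors. [cite: Yang1962, §4] -/
theorem exists_yang (H : TorusHamiltonianFamily) {δ : ℝ} (hδ0 : 0 ≤ δ) (hδ1 : δ ≤ 1) {g : ℝ}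
    (hg : 0 < g) :
    ∃ cert : UniformPairFieldCeilingCert H (electronNumber δ), cert.ε = 2 * (1 - δ ^ 2) + g := by
  obtain ⟨L₀, hL₀⟩ := exists_nat_gt (4 / g)
  refine ⟨⟨2 * (1 - δ ^ 2) + g, max 3 L₀, fun L hL _hE ψ h1 hgs => ?_⟩, rfl⟩
  have hL3 : 3 ≤ L := le_of_max_le_left hL
  have hLL₀ : L₀ ≤ L := le_of_max_le_right hL
  have hψN : IsNParticle (electronNumber δ L) ψ := ((mem_szSector_iff _ _ _).1 hgs.1).1
  refine (pairFieldDensity_le_yang_doping hδ0 hδ1 hL3 hψN h1).trans ?_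
  have hL1 : (1 : ℝ) ≤ (L : ℝ) := by exact_mod_cast (show 1 ≤ L by omega)
  have hLpos : (0 : ℝ) < (L : ℝ) := by linarith
  have hLg : 4 / g < (L : ℝ) := hL₀.trans_le (by exact_mod_cast hLL₀)
  have htail : 4 * (1 - δ) / (L : ℝ) ^ 2 ≤ g := by
    rw [div_le_iff₀ (by positivity)]
    have h4 : 4 < g * (L : ℝ) := by
      have := (div_lt_iff₀ hg).1 hLg
      linarith [this]
    nlinarith [mul_le_mul_of_nonneg_left hL1 (le_of_lt (mul_pos hg hLpos))]
  linarith

end UniformPairFieldCeilingCert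

/-- **Yang's kinematic ceiling on the `d`-wave order parameter (any Hamiltonian, rung 0)**: for every
hole doping `δ ∈ [0, 1]`, every family `H` and every admissible sequence of unit sector ground states,
`limsup_k dWaveOrderParamSq ψ k ≤ 2(1 − δ²)`. This is the number a certificate-based ceiling
(`UpperBlockCertTT'.limsup_dWaveOrderParamSq_le`, `R4CeilingBlockCert.limsup_dWaveOrderParamSq_le`)
must beat to carry information about the Hamiltonian. [cite: Yang1962, §4] -/
theorem limsup_dWaveOrderParamSq_le_yang (H : TorusHamiltonianFamily) {δ : ℝ} (hδ0 : 0 ≤ δ)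
    (hδ1 : δ ≤ 1) (ψ : ∀ L, Fock (Orb (FermionTorus 2 L)))
    (hψ : ∀ L, Even L → star (ψ L) ⬝ᵥ ψ L = 1 ∧
      IsGroundStateInSector (H L) (electronNumber δ L) 0 (ψ L)) :
    limsup (dWaveOrderParamSq ψ) atTop ≤ 2 * (1 - δ ^ 2) := by
  refine le_of_forall_pos_le_add fun g hg => ?_
  obtain ⟨cert, hε⟩ := UniformPairFieldCeilingCert.exists_yang H hδ0 hδ1 hg
  exact hε ▸ cert.limsup_dWaveOrderParamSq_le ψ hψ

/-- **The number of record at doping `1/8` (rung 0, kinematic, any `H`)**: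
`limsup_k dWaveOrderParamSq ψ k ≤ 63/32 = 1.96875` for every admissible sequence of unit ground
states of the sector `(electronNumber (1/8) L, S^z = 0)` — in particular for `hubbardTorusTT' L 1 t' 8`
and the pure model. HONEST LABEL: kinematic (Pauli principle only); the physical order parameter is
three orders of magnitude smaller; an `R4CeilingBlockCert` is informative only if its `E < 63/32`.
[cite: Yang1962, §4] -/
theorem limsup_dWaveOrderParamSq_le_yang_eighth (H : TorusHamiltonianFamily)
    (ψ : ∀ L, Fock (Orb (FermionTorus 2 L)))
    (hψ : ∀ L, Even L → star (ψ L) ⬝ᵥ ψ L = 1 ∧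
      IsGroundStateInSector (H L) (electronNumber (1 / 8) L) 0 (ψ L)) :
    limsup (dWaveOrderParamSq ψ) atTop ≤ 63 / 32 := by
  have h := limsup_dWaveOrderParamSq_le_yang H (δ := 1 / 8) (by norm_num) (by norm_num) ψ hψ
  norm_num at h
  exact h

end

end Summit.HubbardSuperconductivity.HubbardLadder
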